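import Mathlib
import Literature.Algebra.EuclideanLattices.IntegerBases
import HarnessLib

/-!
# Lenstra's algorithm in fixed dimension, V: two integer bases of one lattice differ by a unimodular matrix

Topic `Computability/Complexity`, grouping namespace `FixedDimILP`. Lenstra's algorithm replaces the
basis `B₀` (rows) of the lattice `L = {Σ xᵢ b⁰ᵢ | x ∈ ℤ^N}` by a reduced basis `B₁` of the SAME lattice
(LLL82, (1.4)–(1.5); in the tree `LLLMachine.lllMachineF`, whose specification is exactly
`L(B₁) = L(B₀)`), and then needs the transition matrices in both directions, as INTEGER matrices:
`B₁ = U B₀`, `B₀ = U' B₁`, `U U' = U' U = 1` — the coordinates of an integer point in the new basis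
(`x ↦ x U'`), the new last coordinate `c · x` with `c` the last column of `U'` (file III), and the
parametrisation of its level sets by `U` (file IV). On the tree's `LatticeInstance` (rows generate):

* `exists_mul_of_lattice_le` — `L(B₁) ≤ L(B₀)` gives an integer `U` with `B₁ = U * B₀`;
* `mul_eq_one_of_mul_mul` — `B₀ = U' (U B₀)` with `det B₀ ≠ 0` forces `U' U = 1` (and `U U' = 1`);
* **`exists_unimodular_of_lattice_eq`** — the package: `U`, `U'`, both products `1`, `det B₁ ≠ 0`;
* `eq_map_ediv_of_mul` — the machine's formula: if `B₀ G₀ = d₀ • 1` (`d₀ ≠ 0`; in the tree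
  `GSInverse.mul_invMatrix`: `G₀ = invMatrix B₀`, `d₀ = det(B₀)²`) and `B₁ = U B₀` then
  `U = (B₁ G₀) / d₀` entrywise, an EXACT integer division; `linearIndependent_rowsR` (`det ≠ 0`).

## References

* A. K. Lenstra, H. W. Lenstra, L. Lovász, *Factoring polynomials with rational coefficients*, Math. Ann.
  261 (1982), §1 ((1.4)–(1.5): the reduction algorithm transforms a basis into a basis of the same
  lattice). [LenstraLenstraLovasz1982]
* A. Schrijver, *Theory of Linear and Integer Programming*, Wiley 1986, Cor. 4.3b–c (two bases of a
  lattice differ by a unimodular matrix), Cor. 18.7a (the unimodular `[c; U]`). [Schrijver1986]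
-/

namespace Literature.Computability.Complexity

namespace FixedDimILP

open Matrix Literature.Algebra.EuclideanLattices

variable {N : ℕ}

/-! ### From lattice inclusion to an integer transition matrix -/

/-- **`L(B₁) ≤ L(B₀)` gives an integer matrix `U` with `B₁ = U B₀`** (each row of `B₁` is an integer
combination of the rows of `B₀`). [cite: Schrijver1986, Cor. 4.3b] -/
theorem exists_mul_of_lattice_le {B₀ B₁ : Matrix (Fin N) (Fin N) ℤ}
    (h : (⟨N, B₁⟩ : LatticeInstance).lattice ≤ (⟨N, B₀⟩ : LatticeInstance).lattice) :
    ∃ U : Matrix (Fin N) (Fin N) ℤ, B₁ = U * B₀ := by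
  have hrow : ∀ i : Fin N, ∃ z : Fin N → ℤ, B₁ i = z ᵥ* B₀ := by
    intro i
    have hmem : (⟨N, B₁⟩ : LatticeInstance).vec i ∈ (⟨N, B₀⟩ : LatticeInstance).lattice :=
      h (Submodule.subset_span ⟨i, rfl⟩)
    obtain ⟨z, hz⟩ := ((⟨N, B₀⟩ : LatticeInstance).mem_lattice_iff _).1 hmem
    refine ⟨z, intVecToEuclidean_injective N ?_⟩
    exact hz.symm
  choose z hz using hrow
  refine ⟨Matrix.of z, ?_⟩
  ext i j
  rw [Matrix.mul_apply_eq_vecMul]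
  exact congrFun (hz i) j

/-! ### Cancelling a nonsingular integer matrix -/

/-- If `M B₀ = 0` and `det B₀ ≠ 0` then `M = 0` (multiply by the adjugate: `det B₀ • M = 0` in `ℤ`).
[folklore] -/
theorem eq_zero_of_mul_eq_zero {M B₀ : Matrix (Fin N) (Fin N) ℤ} (hB : B₀.det ≠ 0) (h : M * B₀ = 0) : M = 0 := by
  have h1 : M * B₀ * B₀.adjugate = 0 := by rw [h, Matrix.zero_mul]
  rw [Matrix.mul_assoc, Matrix.mul_adjugate, Matrix.mul_smul, Matrix.mul_one] at h1
  ext i j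
  have := congrFun (congrFun h1 i) j
  simp only [Matrix.smul_apply, smul_eq_mul, Matrix.zero_apply, mul_eq_zero] at this
  exact this.resolve_left hB

/-- **`B₀ = U' (U B₀)` with `det B₀ ≠ 0` forces `U' U = 1`.** [cite: Schrijver1986, Cor. 4.3c] -/
theorem mul_eq_one_of_mul_mul {B₀ U U' : Matrix (Fin N) (Fin N) ℤ} (hB : B₀.det ≠ 0)
    (h : B₀ = U' * (U * B₀)) : U' * U = 1 := by
  have h0 : (U' * U - 1) * B₀ = 0 := by
    rw [Matrix.sub_mul, Matrix.one_mul, Matrix.mul_assoc, ← h, sub_self]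
  have := eq_zero_of_mul_eq_zero hB h0
  exact sub_eq_zero.1 this

/-- **Two integer bases of the same full-rank lattice differ by a unimodular matrix**: from
`L(B₁) = L(B₀)` and `det B₀ ≠ 0` one gets integer `U`, `U'` with `B₁ = U B₀`, `B₀ = U' B₁`,
`U' U = U U' = 1`, and `det B₁ ≠ 0`. [cite: Schrijver1986, Cor. 4.3b–c] [cite: LenstraLenstraLovasz1982, §1 ((1.4)–(1.5), same lattice)] -/
theorem exists_unimodular_of_lattice_eq {B₀ B₁ : Matrix (Fin N) (Fin N) ℤ} (hB : B₀.det ≠ 0)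
    (h : (⟨N, B₁⟩ : LatticeInstance).lattice = (⟨N, B₀⟩ : LatticeInstance).lattice) :
    ∃ U U' : Matrix (Fin N) (Fin N) ℤ, B₁ = U * B₀ ∧ B₀ = U' * B₁ ∧ U' * U = 1 ∧ U * U' = 1 ∧ B₁.det ≠ 0 := by
  obtain ⟨U, hU⟩ := exists_mul_of_lattice_le h.le
  obtain ⟨U', hU'⟩ := exists_mul_of_lattice_le h.ge
  have h1 : U' * U = 1 := mul_eq_one_of_mul_mul hB (by rw [← hU]; exact hU')
  have h2 : U * U' = 1 := mul_eq_one_comm.1 h1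
  refine ⟨U, U', hU, hU', h1, h2, ?_⟩
  have hdetU : U.det ≠ 0 := by
    intro h0
    have := congrArg Matrix.det h1
    rw [Matrix.det_mul, Matrix.det_one, h0, mul_zero] at this
    exact zero_ne_one this
  rw [hU, Matrix.det_mul]
  exact mul_ne_zero hdetU hB

/-! ### The machine's formula for the transition matrices: an exact division -/

/-- **If `B₀ G₀ = d₀ • 1` (`d₀ ≠ 0`) and `B₁ = U B₀` then `U = (B₁ G₀) / d₀` entrywise**, the division
being exact (`B₁ G₀ = d₀ • U`). With `G₀ = invMatrix B₀`, `d₀ = det(B₀)²` (tree: `GSInverse.mul_invMatrix`)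
this is how the machine obtains `U` with integers only. [cite: Schrijver1986, Cor. 4.3b (computing the transition matrix)] -/
theorem eq_map_ediv_of_mul {B₀ B₁ G₀ U : Matrix (Fin N) (Fin N) ℤ} {d₀ : ℤ} (hd : d₀ ≠ 0)
    (hG : B₀ * G₀ = d₀ • (1 : Matrix (Fin N) (Fin N) ℤ)) (hU : B₁ = U * B₀) :
    U = (B₁ * G₀).map (· / d₀) := by
  have hprod : B₁ * G₀ = d₀ • U := by
    rw [hU, Matrix.mul_assoc, hG, Matrix.mul_smul, Matrix.mul_one]
  ext i j
  rw [Matrix.map_apply, hprod, Matrix.smul_apply, smul_eq_mul, Int.mul_ediv_cancel_left _ hd]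

/-- The exact division, as a divisibility statement: `d₀ ∣ (B₁ G₀) i j`. [folklore] -/
theorem dvd_mul_apply_of_mul {B₀ B₁ G₀ U : Matrix (Fin N) (Fin N) ℤ} {d₀ : ℤ}
    (hG : B₀ * G₀ = d₀ • (1 : Matrix (Fin N) (Fin N) ℤ)) (hU : B₁ = U * B₀) (i j : Fin N) :
    d₀ ∣ (B₁ * G₀) i j := by
  have hprod : B₁ * G₀ = d₀ • U := by
    rw [hU, Matrix.mul_assoc, hG, Matrix.mul_smul, Matrix.mul_one]
  rw [hprod, Matrix.smul_apply, smul_eq_mul]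
  exact dvd_mul_right _ _

/-! ### Independence of the rows of a nonsingular integer matrix -/

/-- The rows of a nonsingular integer matrix, read in `ℝ^N`, are linearly independent (the form
`Babai.rowsR` / `LatticeInstance.vec` of the tree). [folklore] -/
theorem linearIndependent_rowsR {B : Matrix (Fin N) (Fin N) ℤ} (hB : B.det ≠ 0) :
    LinearIndependent ℝ (fun i => intVecToEuclidean N (B i)) :=
  LatticeInstance.linearIndependent_vec (I := ⟨N, B⟩) hB

end FixedDimILP

end Literature.Computability.Complexity
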